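import Mathlib
import HarnessLib
import HarnessLib.Audit.Tags
import Summits.HodgeConjecture.HodgeConjecture.Theorems.HodgeLocusCensusRamified7BCore

/-!
# HodgeLocusCensusRamified7CompanionBCore — ENGINE B (pub-hlocus abs-2, gen 32): finite core of the engine-B COUNTERSIGN of the
ROW 7 ADDENDUM (companion column `v'(j(C) - 255³)`, HALF LAW, (HL) identities; V3-XT N = 1, `ℓ = 7` ramified).

HONEST FRAMING: certified instances and evidence bearing on the general Hodge conjecture; no claim.

Informal companion: `run/shared/lean/pub/pub-hlocus/code/abs_engineB/v3B/xt/n1ram7/DERIVATION-R7-B.md` §9 (engine A's finite core of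
the addendum is `HodgeLocusCensusRamified7Companion`; the statements below are engine B's own and do not repeat it).  Engine B derives the
companion law `v'(j(E_C) - 16581375) = 2 + v₇(7b'² + c²)` from the SECOND splitting of the maximal order `O = ℤ⟨1, i, (1+j)/2, (i+k)/2⟩`
of `(-1,-7)_ℚ`, along `k = ij` instead of `j`: `k² = -7`, `ik = -ki`, `ki = j`, `O ⊗ ℤ₇ = ℤ₇[k] ⊕ ℤ₇[k]·i`, and the admissible vector
`y = 7b'i + cj + dk` equals `dk + (7b' + ck)·i` with `N(7b' + ck) = 7(7b'² + c²)`; the norm-residue lemma of the BCore file then gives the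
Gross level `1 + v₇(7b'² + c²)` relative to `ψ' : √-7 ↦ k`.  Globally `ℤ[k] = O ∩ ℚ(k)` has conductor `2` (`(1+k)/2 ∉ O`), which is why
the CM value is `j(ℤ[√-7]) = 255³`; `7`-adically `ℤ₇[k]` is maximal, so [cite: KudlaRapoportYang2006, (3.6.11)–(3.6.12)] applies with `r = 0`.
The (HL) identities were proved by engine B as identities in `M_{3/2}(Γ₀(196), (28/·))` with PARI's `mf` package (kit j131706); only the
arithmetic of that certificate (Gram matrices ↔ forms, the twist projection, the plan-B Sturm arithmetic) is kernel-checked here.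

Kernel-checked (no `sorry`, no new axioms; `decide` / `norm_num` / `ring` / `omega`):
* `O_membership_criterion`, `one_plus_k_half_not_in_O`, `O_cap_Qk` — membership of `(p + qi + rj + sk)/2` in `O` is
  `p ≡ r ∧ q ≡ s (mod 2)`; `(1+j)/2, (i+k)/2 ∈ O`, `(1+k)/2 ∉ O`, and `O ∩ ℚ(k) = ℤ[k]`;
* `i_anticommutes_k`, `k_sq`, `k_mul_i`, `conj_i_negates_k` — `ik + ki = 0`, `k² = -7`, `ki = j`, `i k i⁻¹ = -k`;
* `split_k_coords`, `nrd_split_k`, `embed_coords_k` — `(a₀ + a₁k) + (b₀ + b₁k)·i = a₀ + b₀i + b₁j + a₁k`, `nrd = N(α) + N(β)`,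
  `dk + (7b' + ck)·i = 7b'i + cj + dk`, `N(7b' + ck) = 7(7b'² + c²)`;
* (the level law `v₇(49b'² + 7c²) = 1 + v₇(7b'² + c²)` and `v' = 2 + v₇(7b'² + c²)` are `Ramified7BCore.level_eq/vprime_eq` applied to `(b', c)`);
* `exclusion_valuation` — `16581375 + 3375 = 7 · 2369250` with `7 ∤ 2369250` (so no class is deep at both CM values), and the vector form
  `7 ∣ c → 7 ∣ d → 7 ∣ 7b'² + c² + d²`;
* `gram_forms` — the six Gram matrices fed to `mffromqf` encode `2·(A c² + B Θ₇(x,y))` for `(A,B) = (1,1),(1,7),(49,1),(1,4),(1,28),(49,4)`;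
* `twist_projection`, `squares_mod_seven` — `ψ + ψ² = 2·[ψ = 1]` on `{0, ±1}` (the projection onto `(n/7) = +1` by two quadratic twists) and
  the squares mod `7` are `{1, 2, 4}`;
* `planB_sturm_arithmetic` — `49 · 196 = 9604`, `[SL₂(ℤ) : Γ₀(9604)] = 9604 · (3/2) · (8/7) = 16464`, `⌊(3/2)/12 · 16464⌋ = 2058 ≤ 2060`;
* `half_law_from_HL4_numerals` — the anchor `m = 29`: `r(29; c²+28Θ₇) = 4 = 2ν`, `r(29; 49c²+4Θ₇) = 0 = 2μ`, `r(29; c²+4Θ₇) = 8 = 2h`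
  (counted by `decide` over complete boxes) and `2·4 + 2·0 - 8 = 0 = 2u₂₉`, i.e. (HL4) at `n = 29` and `ν + μ = 2 = h/2`.
-/

set_option maxRecDepth 32768

namespace Summit.HodgeConjecture.HodgeConjecture.HodgeLocus.Census.Ramified7CompanionBCore

open Summit.HodgeConjecture.HodgeConjecture.HodgeLocus.Census.Ramified7BCore

/-! ### Membership in `O = ℤ⟨1, i, (1+j)/2, (i+k)/2⟩` for half-integral coordinate vectors -/

/-- `(p + q i + r j + s k)/2 ∈ O = ℤ⟨1, i, (1+j)/2, (i+k)/2⟩` means `(p,q,r,s) = (2n₁+n₃, 2n₂+n₄, n₃, n₄)` for integers `nᵢ`;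
this is the parity criterion `p ≡ r ∧ q ≡ s (mod 2)` (the exact membership test of `r7lat.inO`). -/
theorem O_membership_criterion (p q r s : ℤ) :
    (∃ n₁ n₂ n₃ n₄ : ℤ, p = 2 * n₁ + n₃ ∧ q = 2 * n₂ + n₄ ∧ r = n₃ ∧ s = n₄) ↔ (2 ∣ p - r ∧ 2 ∣ q - s) := by
  constructor
  · rintro ⟨n₁, n₂, n₃, n₄, hp, hq, hr, hs⟩
    exact ⟨⟨n₁, by omega⟩, ⟨n₂, by omega⟩⟩
  · rintro ⟨⟨a, ha⟩, ⟨b, hb⟩⟩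
    exact ⟨a, b, r, s, by omega, by omega, rfl, rfl⟩

/-- `(1+j)/2 ∈ O` and `(i+k)/2 ∈ O` (doubled coordinates `(1,0,1,0)`, `(0,1,0,1)`), but `(1+k)/2 ∉ O` (`(1,0,0,1)`):
`ℤ[(1+√-7)/2]` embeds optimally through `j`, whereas through `k` only `ℤ[√-7] = ℤ[k]` does. -/
theorem one_plus_k_half_not_in_O :
    (2 ∣ (1 : ℤ) - 1 ∧ 2 ∣ (0 : ℤ) - 0) ∧ (2 ∣ (0 : ℤ) - 0 ∧ 2 ∣ (1 : ℤ) - 1) ∧ ¬ (2 ∣ (1 : ℤ) - 0 ∧ 2 ∣ (0 : ℤ) - 1) := by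
  decide

/-- `O ∩ ℚ(k) = ℤ[k]`: `(p + s k)/2 ∈ O ⟺ p, s` even — the order of `ℚ(√-7)` optimally embedded by `ψ' : √-7 ↦ k` is `ℤ[√-7]`
(conductor `2`, `j = 255³ = 16581375`), `7`-adically maximal. -/
theorem O_cap_Qk (p s : ℤ) : (2 ∣ p - 0 ∧ 2 ∣ (0 : ℤ) - s) ↔ (2 ∣ p ∧ 2 ∣ s) := by
  simp [dvd_neg, sub_zero, zero_sub]

/-! ### The element `k = ij` -/

/-- `ik + ki = 0`. -/
theorem i_anticommutes_k : qmul qi qk + qmul qk qi = 0 := by decide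

/-- `k² = -7` and `ki = j` (so `j ∈ ℤ[k]·i`). -/
theorem k_sq : qmul qk qk = (-7, 0, 0, 0) := by decide

/-- `ki = j`. -/
theorem k_mul_i : qmul qk qi = qj := by decide

/-- `i k i⁻¹ = -k` (`i⁻¹ = -i`): `[i]` exchanges the canonical-lift loci of `ψ'` and `-ψ'`, both with `j = 255³`. -/
theorem conj_i_negates_k : qmul (qmul qi qk) (0, -1, 0, 0) = (0, 0, 0, -1) := by decide

/-! ### The second splitting `O ⊗ ℤ₇ = ℤ₇[k] ⊕ ℤ₇[k]·i` -/

/-- `(a₀ + a₁ k) + (b₀ + b₁ k)·i = a₀ + b₀ i + b₁ j + a₁ k`. -/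
theorem split_k_coords (a₀ a₁ b₀ b₁ : ℤ) :
    (a₀, 0, 0, a₁) + qmul (b₀, 0, 0, b₁) qi = (a₀, b₀, b₁, a₁) := by
  simp only [qmul, qi, Prod.mk_add_mk]; ring_nf

/-- `nrd(a₀ + b₀ i + b₁ j + a₁ k) = N(a₀ + a₁k) + N(b₀ + b₁k)` with `N(u + vk) = u² + 7v²`. -/
theorem nrd_split_k (a₀ a₁ b₀ b₁ : ℤ) :
    nrd (a₀, b₀, b₁, a₁) = (a₀ ^ 2 + 7 * a₁ ^ 2) + (b₀ ^ 2 + 7 * b₁ ^ 2) := by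
  simp only [nrd]; ring

/-- The admissible vector along `k`: `dk + (7b' + ck)·i = 7b'i + cj + dk`, and `N(7b' + ck) = 49b'² + 7c² = 7(7b'² + c²)`. -/
theorem embed_coords_k (b' c d : ℤ) :
    (0, 0, 0, d) + qmul (7 * b', 0, 0, c) qi = (0, 7 * b', c, d) ∧
    (7 * b') ^ 2 + 7 * c ^ 2 = 7 * (7 * b' ^ 2 + c ^ 2) := by
  refine ⟨?_, by ring⟩
  simp only [qmul, qi, Prod.mk_add_mk]; ring_nf

/- Level relative to `ψ'`: `v₇(N(7b' + ck)) = v₇(49b'² + 7c²) = 1 + v₇(7b'² + c²)` and the companion law's shape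
   `v' = level + 1 = 2 + v₇(7b'² + c²)` are LITERALLY `Ramified7BCore.level_eq b' c` and `Ramified7BCore.vprime_eq b' c`
   (the BCore lemmas are symmetric in the name of the second variable); they are not restated here. -/

/-! ### EXCLUSION -/

/-- `(j + 3375) - (j - 255³) = 16584750 = 7 · 2369250`, `7 ∤ 2369250`: by the ultrametric inequality a class deep at `-3375`
(`v' ≥ 3 > 2 = v'(16584750)`) has `v'(j - 255³) = 2` exactly; vector form: `7 ∣ c ∧ 7 ∣ d ⇒ 7 ∣ M`. -/
theorem exclusion_valuation :
    (16581375 : ℤ) + 3375 = 7 * 2369250 ∧ ¬ (7 : ℤ) ∣ 2369250 ∧ (16581375 : ℤ) = 255 ^ 3 ∧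
    ∀ b' c d : ℤ, 7 ∣ c → 7 ∣ d → 7 ∣ 7 * b' ^ 2 + c ^ 2 + d ^ 2 := by
  refine ⟨by norm_num, by decide, by norm_num, ?_⟩
  rintro b' c d ⟨u, rfl⟩ ⟨v, rfl⟩
  exact ⟨b' ^ 2 + 7 * u ^ 2 + 7 * v ^ 2, by ring⟩

/-! ### Arithmetic of the modular-forms certificate of (HL1)/(HL4) (kit j131706) -/

/-- The Gram matrices `[2A,0,0; 0,2B,B; 0,B,4B]` given to `mffromqf` have `vᵀ M v = 2(A c² + B Θ₇(x,y))` for the six `(A,B)`. -/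
theorem gram_forms (c x y : ℤ) :
    (2 * c * c + (2 * x * x + x * y + y * x + 4 * y * y) = 2 * (c ^ 2 + theta7 x y)) ∧
    (2 * c * c + (14 * x * x + 7 * x * y + 7 * y * x + 28 * y * y) = 2 * (c ^ 2 + 7 * theta7 x y)) ∧
    (98 * c * c + (2 * x * x + x * y + y * x + 4 * y * y) = 2 * (49 * c ^ 2 + theta7 x y)) ∧
    (2 * c * c + (8 * x * x + 4 * x * y + 4 * y * x + 16 * y * y) = 2 * (c ^ 2 + 4 * theta7 x y)) ∧
    (2 * c * c + (56 * x * x + 28 * x * y + 28 * y * x + 112 * y * y) = 2 * (c ^ 2 + 28 * theta7 x y)) ∧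
    (98 * c * c + (8 * x * x + 4 * x * y + 4 * y * x + 16 * y * y) = 2 * (49 * c ^ 2 + 4 * theta7 x y)) := by
  simp only [theta7]; refine ⟨by ring, by ring, by ring, by ring, by ring, by ring⟩

/-- The projection onto `(n/7) = +1` inside the space: for `ψ ∈ {0, 1, -1}`, `ψ + ψ·ψ = 2·[ψ = 1]`
(coefficients of `G⊗ψ + (G⊗ψ)⊗ψ` are `2g_n` on the class and `0` elsewhere). -/
theorem twist_projection (e g : ℤ) (he : e = 0 ∨ e = 1 ∨ e = -1) :
    e * g + e * (e * g) = if e = 1 then 2 * g else 0 := by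
  rcases he with rfl | rfl | rfl <;> simp; ring

/-- The class `(n/7) = +1` is `n mod 7 ∈ {1, 2, 4}` (the nonzero squares mod `7`). -/
theorem squares_mod_seven : ∀ n : ZMod 7, (∃ x : ZMod 7, x ≠ 0 ∧ x ^ 2 = n) ↔ (n = 1 ∨ n = 2 ∨ n = 4) := by decide

/-- Plan-B Sturm arithmetic: twist level bound `49 · 196 = 9604 = 2² · 7⁴`, index `9604 · (1 + 1/2) · (1 + 1/7) = 16464`,
weight-`3/2` Sturm bound `⌊16464 · 3 / 24⌋ = 2058 ≤ 2060` (the range checked class-wise in the certificate). -/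
theorem planB_sturm_arithmetic :
    49 * 196 = 9604 ∧ 9604 = 2 ^ 2 * 7 ^ 4 ∧ 9604 * 3 * 8 = 16464 * 2 * 7 ∧ 16464 * 3 / 24 = 2058 ∧ 2058 ≤ 2060 ∧
    196 = 2 ^ 2 * 7 ^ 2 ∧ 196 * 3 * 8 = 336 * 2 * 7 := by
  norm_num

/-! ### (HL4) and the HALF LAW at the anchor `m = 29` by complete enumeration -/

/-- `r(29; c² + 28Θ₇) = 4`, `r(29; 49c² + 4Θ₇) = 0`, `r(29; c² + 4Θ₇) = 8` over complete boxes (`c² ≤ 29`, `7x² ≤ 8Θ₇ ≤ 58`,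
`7y² ≤ 4Θ₇ ≤ 29` by `theta_box`), hence (HL4) at `n = 29`: `2·4 + 2·0 - 8 = 0 = 2u₂₉`, and `ν + μ = 2 + 0 = h/2` for `D = -203` (`h = 4`). -/
theorem half_law_from_HL4_numerals :
    ((Finset.Icc (-5 : ℤ) 5 ×ˢ Finset.Icc (-3 : ℤ) 3 ×ˢ Finset.Icc (-3 : ℤ) 3).filter
        (fun v => v.1 ^ 2 + 28 * theta7 v.2.1 v.2.2 = 29)).card = 4 ∧
    ((Finset.Icc (-1 : ℤ) 1 ×ˢ Finset.Icc (-3 : ℤ) 3 ×ˢ Finset.Icc (-3 : ℤ) 3).filter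
        (fun v => 49 * v.1 ^ 2 + 4 * theta7 v.2.1 v.2.2 = 29)).card = 0 ∧
    ((Finset.Icc (-5 : ℤ) 5 ×ˢ Finset.Icc (-3 : ℤ) 3 ×ˢ Finset.Icc (-3 : ℤ) 3).filter
        (fun v => v.1 ^ 2 + 4 * theta7 v.2.1 v.2.2 = 29)).card = 8 ∧
    (2 * 4 + 2 * 0 - 8 : ℤ) = 0 ∧ (2 : ℤ) + 0 = 4 / 2 := by
  refine ⟨by decide, by decide, by decide, by norm_num, by norm_num⟩

end Summit.HodgeConjecture.HodgeConjecture.HodgeLocus.Census.Ramified7CompanionBCore
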